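import Mathlib
import HarnessLib
import Summits.AtomisticToContinuum.FouriersLaw.Theses.JunctionLocality
import Literature.MathematicalPhysics.KineticTheory.ChainReflection
import Summits.AtomisticToContinuum.FouriersLaw.Theorems.JunctionLocalitySuperadditiveResistanceDeviceLiouville
import Summits.AtomisticToContinuum.FouriersLaw.Theorems.JunctionLocalitySuperadditiveResistanceKuboKernel

/-!
# The plain chain's Kubo conductance is an Onsager quantity: `0 < G_L ≤ γ`
# (line `floating-probe-bypass-laplacian`, crux stmt-AtomisticToContinuum-11748)

Instance `m = 2` of the terminal-frame theorem `kubo_onsager_terminal`: for the PLAIN `L`-chain `pinnedChain ω₂ lam β γ`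
(all `> 0`, `L ≥ 2`; baths of friction `γ` on sites `0` and `L−1`, equal temperatures `T > 0`) and any left forward
field `g ∈ plainForwardFields … L` (classical mean-zero `C² ∩ L²(μ_T)` solution of `L_{T,T} g = −(p_0² − T)`), the
REFLECTED field `g ∘ R` (`R` = site reflection of `ChainReflection.lean`; `V` is even) is the forward field of the
RIGHT bath, so the pair `(g, g ∘ R)` is a two-terminal frame and the `2 × 2` Kubo matrix is an Onsager Laplacian.
Consequences recorded for the line: `plainKubo_pos` (`0 < G_L`: kernel = constants, tested on `θ = (1, 0)`) and
`plainKubo_le` (`G_L ≤ γ`: fluctuation–dissipation). With the Kubo link (`stub_plainKuboLink`) this is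
`0 < D_L/(L−1) ≤ γ` for the crux's response coefficients (PositiveConductance in Kubo form, fixed `L`).
Vocabulary `plainForwardFields`, `plainKubo` verbatim copies of the skeleton's (own namespace `…Theorems…KuboPlain`, to stay
independent of the other stub files; the copies are definitionally the skeleton's). Standard axioms only.
-/

noncomputable section

open MeasureTheory Filter Topology
open scoped ContDiff
open Literature.MathematicalPhysics.KineticTheory.HeatConduction
open Summit.AtomisticToContinuum.FouriersLaw.Theorems.SuperadditiveResistance.DeviceLiouville
  (kin kin_eq_sq liouvilleOp bathOp)
open Summit.AtomisticToContinuum.FouriersLaw.Theorems.SuperadditiveResistance.Kubo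
  (termWeight termWeight_nonneg kubo_onsager_terminal fluctuation_dissipation memLp_kinetic partition_pos
    memLp_of_integrable_sq_mul_gibbsDensity integrable_sq_mul_gibbsDensity)

namespace Summit.AtomisticToContinuum.FouriersLaw.Theorems.SuperadditiveResistance.KuboPlain

/-! ## Vocabulary (verbatim from the registered skeleton) -/

/-- The set of equilibrium forward fields of the LEFT bath of the plain `L`-chain: classical mean-zero
`C² ∩ L²(μ_T)` solutions of `L_{T,T} g = −(p_0² − T)`. -/
def plainForwardFields (ω₂ lam β γ T : ℝ) (L : ℕ) : Set (PhaseSpace L → ℝ) :=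
  {g | ContDiff ℝ 2 g ∧ MemLp g 2 ((pinnedChain ω₂ lam β γ).gibbsMeasure L T) ∧
    ∫ x, g x ∂((pinnedChain ω₂ lam β γ).gibbsMeasure L T) = 0 ∧
    ∀ x, (pinnedChain ω₂ lam β γ).generator L T T g x = -(kin L 0 x - T)}

/-- The plain chain's two-terminal KUBO CONDUCTANCE read off a left forward field:
`G = γ(1 − (γ/T²)⟨g, p_0² − T⟩_{μ_T})` (= `K_00` of the `2 × 2` Kubo matrix; by its zero row sum it is the
linear-response current per unit bias `T_L − T_R`). -/
def plainKubo (ω₂ lam β γ T : ℝ) (L : ℕ) (g : PhaseSpace L → ℝ) : ℝ :=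
  γ * (1 - γ / T ^ 2 * ∫ x, g x * (kin L 0 x - T) ∂((pinnedChain ω₂ lam β γ).gibbsMeasure L T))

/-! ## The plain chain as a two-terminal frame -/

/-- At equal bath temperatures the plain generator is `X_H + γ S_B` with `B = bathWeight`. -/
theorem generator_eq_liouvilleOp_add_bathOp (P : OscillatorChain) (L : ℕ) (T : ℝ) (f : PhaseSpace L → ℝ)
    (x : PhaseSpace L) :
    P.generator L T T f x = liouvilleOp P L f x + P.γ * bathOp L (OscillatorChain.bathWeight L) T f x := by
  simp only [OscillatorChain.generator, liouvilleOp, bathOp, OscillatorChain.bathWeight]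
  congr 1
  congr 1
  refine Finset.sum_congr rfl fun i _ => ?_
  split_ifs <;> ring

/-- The two bath sites `0, L−1` of the plain chain (`L ≥ 1`). -/
def bathFin (L : ℕ) (hL : 1 ≤ L) : Fin 2 → Fin L := ![⟨0, by omega⟩, ⟨L - 1, by omega⟩]

/-- `bathFin L _ 0 = 0`. -/
theorem bathFin_zero {L : ℕ} (hL : 1 ≤ L) : bathFin L hL 0 = ⟨0, by omega⟩ := rfl
/-- `bathFin L _ 1 = L − 1`. -/
theorem bathFin_one {L : ℕ} (hL : 1 ≤ L) : bathFin L hL 1 = ⟨L - 1, by omega⟩ := rfl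

/-- For `L ≥ 2` the two bath sites are distinct. -/
theorem bathFin_injective {L : ℕ} (hL : 2 ≤ L) : Function.Injective (bathFin L (by omega)) := by
  intro a b h
  have hv := congrArg Fin.val h
  fin_cases a <;> fin_cases b <;>
    simp only [bathFin_zero, bathFin_one, Fin.zero_eta, Fin.mk_one, Fin.isValue] at hv ⊢ <;> omega

/-- The indicator of a bath site, written on the value. -/
theorem ite_bathFin_eq {L : ℕ} (hL : 1 ≤ L) (a : Fin 2) (i : Fin L) :
    (if bathFin L hL a = i then (1 : ℝ) else 0) = if i.val = (bathFin L hL a).val then 1 else 0 := by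
  by_cases h : i.val = (bathFin L hL a).val
  · rw [if_pos h, if_pos (Fin.ext h.symm)]
  · rw [if_neg h, if_neg fun e => h (congrArg Fin.val e).symm]

/-- For `L ≥ 2` the bath weights of the plain chain are the terminal weights of the two bath sites. -/
theorem bathWeight_eq_termWeight {L : ℕ} (hL : 2 ≤ L) :
    OscillatorChain.bathWeight L = termWeight (bathFin L (by omega)) := by
  funext i
  rw [termWeight, Fin.sum_univ_two, ite_bathFin_eq, ite_bathFin_eq, bathFin_zero, bathFin_one]
  simp only [OscillatorChain.bathWeight]

/-! ## The reflected field is the right bath's forward field -/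

/-- The site reflection as a measurable equivalence built from coordinate permutations (so that Lebesgue measure is
visibly preserved). -/
def reflM (L : ℕ) : PhaseSpace L ≃ᵐ PhaseSpace L :=
  MeasurableEquiv.prodCongr (MeasurableEquiv.piCongrLeft (fun _ : Fin L => ℝ) Fin.revPerm.symm)
    (MeasurableEquiv.piCongrLeft (fun _ : Fin L => ℝ) Fin.revPerm.symm)

/-- `reflM` acts as `siteReflection`. -/
@[simp] theorem reflM_apply (L : ℕ) (x : PhaseSpace L) : reflM L x = siteReflection L x := by
  refine Prod.ext (funext fun i => ?_) (funext fun i => ?_)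
  · show (MeasurableEquiv.piCongrLeft (fun _ : Fin L => ℝ) Fin.revPerm.symm) x.1 i = x.1 (Fin.rev i)
    rw [MeasurableEquiv.coe_piCongrLeft, Equiv.piCongrLeft_apply_eq_cast]
    simp
  · show (MeasurableEquiv.piCongrLeft (fun _ : Fin L => ℝ) Fin.revPerm.symm) x.2 i = x.2 (Fin.rev i)
    rw [MeasurableEquiv.coe_piCongrLeft, Equiv.piCongrLeft_apply_eq_cast]
    simp

/-- The site reflection preserves Lebesgue measure on phase space. -/
theorem measurePreserving_reflM (L : ℕ) : MeasurePreserving (reflM L) (volume : Measure (PhaseSpace L)) volume :=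
  (volume_measurePreserving_piCongrLeft (fun _ : Fin L => ℝ) Fin.revPerm.symm).prod
    (volume_measurePreserving_piCongrLeft (fun _ : Fin L => ℝ) Fin.revPerm.symm)

/-- `L²(μ_T)` is reflection invariant for continuous observables (even `V`). -/
theorem memLp_comp_siteReflection {ω₂ lam β γ T : ℝ} (hω : 0 < ω₂) (hl : 0 ≤ lam) (hβ : 0 ≤ β) (hT : 0 < T)
    {L : ℕ} {g : PhaseSpace L → ℝ} (hgc : Continuous g) (hg : MemLp g 2 ((pinnedChain ω₂ lam β γ).gibbsMeasure L T)) :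
    MemLp (g ∘ siteReflection L) 2 ((pinnedChain ω₂ lam β γ).gibbsMeasure L T) := by
  refine memLp_of_integrable_sq_mul_gibbsDensity hω hl hβ γ L hT (hgc.comp continuous_siteReflection) ?_
  have h := integrable_sq_mul_gibbsDensity hω hl hβ γ L hT hg
  have hH : ∀ x, (pinnedChain ω₂ lam β γ).gibbsDensity L T (siteReflection L x) = (pinnedChain ω₂ lam β γ).gibbsDensity L T x :=
    fun x => by simp [OscillatorChain.gibbsDensity,
      (pinnedChain ω₂ lam β γ).hamiltonian_siteReflection (pinnedChain_V_neg ω₂ lam β γ) L x]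
  have h2 := ((measurePreserving_reflM L).integrable_comp_emb (reflM L).measurableEmbedding
    (g := fun x => g x ^ 2 * (pinnedChain ω₂ lam β γ).gibbsDensity L T x)).2 h
  refine h2.congr (ae_of_all _ fun x => ?_)
  simp only [Function.comp_apply, reflM_apply, hH]

/-- **A left forward field reflects to a right forward field** (pinned chain, equal temperatures):
`L_{T,T}(g ∘ R) = −(p_{L−1}² − T)` whenever `L_{T,T} g = −(p_0² − T)`. -/
theorem generator_comp_siteReflection_left (ω₂ lam β γ T : ℝ) {L : ℕ} (hL : 1 ≤ L) {g : PhaseSpace L → ℝ}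
    (hpde : ∀ x, (pinnedChain ω₂ lam β γ).generator L T T g x = -(kin L 0 x - T)) (x : PhaseSpace L) :
    (pinnedChain ω₂ lam β γ).generator L T T (g ∘ siteReflection L) x = -(kin L (L - 1) x - T) := by
  rw [(pinnedChain ω₂ lam β γ).generator_comp_siteReflection (pinnedChain_V_neg ω₂ lam β γ) L T T g x, hpde,
    kin_eq_sq (by omega : 0 < L), kin_eq_sq (by omega : L - 1 < L)]
  simp only [siteReflection_snd]
  congr 2

/-! ## Positivity and the trivial upper bound -/

/-- **The plain chain's Kubo conductance is positive and at most `γ`.** For `pinnedChain ω₂ lam β γ` (all `> 0`),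
`T > 0`, `L ≥ 2` and any `g ∈ plainForwardFields … L`: `0 < plainKubo … g ≤ γ`. -/
theorem plainKubo_pos_and_le (ω₂ lam β γ T : ℝ) (hω : 0 < ω₂) (hl : 0 < lam) (hβ : 0 < β) (hγ : 0 < γ)
    (hT : 0 < T) (L : ℕ) (hL : 2 ≤ L) (g : PhaseSpace L → ℝ) (hg : g ∈ plainForwardFields ω₂ lam β γ T L) :
    0 < plainKubo ω₂ lam β γ T L g ∧ plainKubo ω₂ lam β γ T L g ≤ γ := by
  have hL1 : 1 ≤ L := by omega
  have hL0 : 0 < L := by omega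
  set s := bathFin L hL1 with hs_def
  have hs : Function.Injective s := bathFin_injective hL
  have hs0 : s 0 = ⟨0, hL0⟩ := bathFin_zero hL1
  have hs1 : s 1 = ⟨L - 1, by omega⟩ := bathFin_one hL1
  have hBw : OscillatorChain.bathWeight L = termWeight s := bathWeight_eq_termWeight hL
  obtain ⟨hg2, hgL, -, hpde⟩ := hg
  -- the two-terminal family (g, g ∘ R)
  set G : Fin 2 → PhaseSpace L → ℝ := ![g, g ∘ siteReflection L] with hG
  have hG2 : ∀ a, ContDiff ℝ 2 (G a) := by
    intro a; fin_cases a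
    · exact hg2
    · exact hg2.comp contDiff_siteReflection
  have hGL : ∀ a, MemLp (G a) 2 ((pinnedChain ω₂ lam β γ).gibbsMeasure L T) := by
    intro a; fin_cases a
    · exact hgL
    · exact memLp_comp_siteReflection hω hl.le hβ.le hT hg2.continuous hgL
  have hkin : ∀ (a : Fin 2) (x : PhaseSpace L), kin L (![0, L - 1] a) x = x.2 (s a) ^ 2 := by
    intro a x; fin_cases a
    · show kin L 0 x = x.2 (s 0) ^ 2; rw [hs0]; exact kin_eq_sq hL0 x
    · show kin L (L - 1) x = x.2 (s 1) ^ 2; rw [hs1]; exact kin_eq_sq (by omega) x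
  have hpdeG : ∀ a x, (1 : ℝ) * liouvilleOp (pinnedChain ω₂ lam β γ) L (G a) x +
      γ * bathOp L (termWeight s) T (G a) x = -(x.2 (s a) ^ 2 - T) := by
    intro a x
    have hgen : ∀ (f : PhaseSpace L → ℝ) (y : PhaseSpace L), (pinnedChain ω₂ lam β γ).generator L T T f y =
        liouvilleOp (pinnedChain ω₂ lam β γ) L f y + γ * bathOp L (OscillatorChain.bathWeight L) T f y :=
      fun f y => generator_eq_liouvilleOp_add_bathOp (pinnedChain ω₂ lam β γ) L T f y
    rw [one_mul, ← hBw, ← hgen]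
    fin_cases a
    · show (pinnedChain ω₂ lam β γ).generator L T T g x = -(x.2 (s 0) ^ 2 - T)
      rw [hpde x, ← hkin 0 x]; rfl
    · show (pinnedChain ω₂ lam β γ).generator L T T (g ∘ siteReflection L) x = -(x.2 (s 1) ^ 2 - T)
      rw [generator_comp_siteReflection_left ω₂ lam β γ T hL1 hpde x, ← hkin 1 x]; rfl
  -- the 2 × 2 Kubo matrix and the terminal theorem
  set K : Matrix (Fin 2) (Fin 2) ℝ := fun a b => (if a = b then γ else 0) -
    γ ^ 2 / T ^ 2 * ∫ x, G a x * (x.2 (s b) ^ 2 - T) ∂((pinnedChain ω₂ lam β γ).gibbsMeasure L T) with hK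
  obtain ⟨-, -, hpsd, hker⟩ := kubo_onsager_terminal hω hl.le hβ.le hL0 hT s hs hs0 one_ne_zero hγ hG2 hGL hpdeG K
    (fun a b => rfl)
  have hK00 : K 0 0 = plainKubo ω₂ lam β γ T L g := by
    simp only [hK, if_true, plainKubo]
    have e : ∀ x : PhaseSpace L, kin L 0 x = x.2 (s 0) ^ 2 := fun x => by rw [hs0]; exact kin_eq_sq hL0 x
    simp only [e]
    show γ - γ ^ 2 / T ^ 2 * ∫ x, g x * (x.2 (s 0) ^ 2 - T) ∂((pinnedChain ω₂ lam β γ).gibbsMeasure L T) = _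
    ring
  have hquad : ∑ a, ∑ b, (![1, 0] : Fin 2 → ℝ) a * K a b * (![1, 0] : Fin 2 → ℝ) b = K 0 0 := by
    simp [Fin.sum_univ_two]
  refine ⟨?_, ?_⟩
  · rw [← hK00]
    rcases (hquad ▸ hpsd ![1, 0]).lt_or_eq with hlt | heq
    · exact hlt
    · exfalso
      have := hker ![1, 0] (by rw [hquad]; exact heq.symm) 0 1
      simp at this
  · -- fluctuation–dissipation: ⟨g, p_0² − T⟩ ≥ 0
    have hB0 : ∀ i, 0 ≤ termWeight s i := termWeight_nonneg s
    have hk2 := memLp_kinetic (γ := γ) hω hl.le hβ.le L hT (s 0)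
    have hFD := fluctuation_dissipation hω hl.le hβ.le L hT (termWeight s) hB0 1 hγ hg2 hgL hk2 (hpdeG 0)
    have hI0 : 0 ≤ ∫ x, g x * (x.2 (s 0) ^ 2 - T) * (pinnedChain ω₂ lam β γ).gibbsDensity L T x := by
      rw [hFD]
      refine mul_nonneg (mul_nonneg hγ.le hT.le) (Finset.sum_nonneg fun i _ => mul_nonneg (hB0 i) ?_)
      exact integral_nonneg fun x => mul_nonneg (sq_nonneg _) ((pinnedChain ω₂ lam β γ).gibbsDensity_pos L T x).le
    have hZ : 0 < ∫ x, (pinnedChain ω₂ lam β γ).gibbsDensity L T x := partition_pos hω hl.le hβ.le L hT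
    have hplain : plainKubo ω₂ lam β γ T L g = γ * (1 - γ / T ^ 2 * ((∫ x, (pinnedChain ω₂ lam β γ).gibbsDensity L T x)⁻¹ *
        ∫ x, g x * (x.2 (s 0) ^ 2 - T) * (pinnedChain ω₂ lam β γ).gibbsDensity L T x)) := by
      have e : ∀ x : PhaseSpace L, kin L 0 x = x.2 (s 0) ^ 2 := fun x => by rw [hs0]; exact kin_eq_sq hL0 x
      simp only [plainKubo, e, (pinnedChain ω₂ lam β γ).integral_gibbsMeasure]
    rw [hplain]
    have h1 : 0 ≤ γ / T ^ 2 * ((∫ x, (pinnedChain ω₂ lam β γ).gibbsDensity L T x)⁻¹ *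
        ∫ x, g x * (x.2 (s 0) ^ 2 - T) * (pinnedChain ω₂ lam β γ).gibbsDensity L T x) := by positivity
    nlinarith

/-- **`0 < G_L`**: the plain chain's Kubo conductance is positive (kernel of the Onsager Laplacian = constants). -/
theorem plainKubo_pos (ω₂ lam β γ T : ℝ) (hω : 0 < ω₂) (hl : 0 < lam) (hβ : 0 < β) (hγ : 0 < γ) (hT : 0 < T)
    (L : ℕ) (hL : 2 ≤ L) (g : PhaseSpace L → ℝ) (hg : g ∈ plainForwardFields ω₂ lam β γ T L) :
    0 < plainKubo ω₂ lam β γ T L g :=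
  (plainKubo_pos_and_le ω₂ lam β γ T hω hl hβ hγ hT L hL g hg).1

/-- **`G_L ≤ γ`**: a single Langevin contact cannot pass more than `γ δT` (fluctuation–dissipation). -/
theorem plainKubo_le (ω₂ lam β γ T : ℝ) (hω : 0 < ω₂) (hl : 0 < lam) (hβ : 0 < β) (hγ : 0 < γ) (hT : 0 < T)
    (L : ℕ) (hL : 2 ≤ L) (g : PhaseSpace L → ℝ) (hg : g ∈ plainForwardFields ω₂ lam β γ T L) :
    plainKubo ω₂ lam β γ T L g ≤ γ :=
  (plainKubo_pos_and_le ω₂ lam β γ T hω hl hβ hγ hT L hL g hg).2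

/-- Registered helper sub-goal `helper_plainKuboPos` (= `plainKubo_pos_and_le` in stub form; line
`floating-probe-bypass-laplacian`, crux stmt-AtomisticToContinuum-11748). -/
theorem helper_plainKuboPos : ∀ (ω₂ lam β γ T : ℝ), 0 < ω₂ → 0 < lam → 0 < β → 0 < γ → 0 < T → ∀ (L : ℕ), 2 ≤ L → ∀ (g : PhaseSpace L → ℝ), g ∈ plainForwardFields ω₂ lam β γ T L → 0 < plainKubo ω₂ lam β γ T L g ∧ plainKubo ω₂ lam β γ T L g ≤ γ :=
  plainKubo_pos_and_le

end Summit.AtomisticToContinuum.FouriersLaw.Theorems.SuperadditiveResistance.KuboPlain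

end
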